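import Summits.CriticalPhenomena.PercolationContinuityZ3.Theorems.PercNearOneGluingNoHeavyPcintMeanMem
import Summits.CriticalPhenomena.PercolationContinuityZ3.Theorems.PercNearOneGluingNoHeavyPcintThirdMemKernel
import HarnessLib

/-!
# PCINT lane, reduced-state B3m certificates (bond): the integer kernel mirror of the corner-third unit count

Cell `prim-pcint` (PAPER-2 track (iii)), seat `prim-pcint-2` (gen 4); support file (`--supports stmt-CriticalPhenomena-4575`).
Does NOT build on p205010.  On top of `…ThirdMemKernel`: the list-level test `BondK.cm3P` of a corner-third letter (det-paying,
and the new neighbour is literally `q₁ + e_a` for a remembered `q₁` of age `1` orthogonal to `a`) and the count `BondK.cmuK`,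
with `BondK.cmuK_le_cmu` (the kernel never over-claims the mean unit).  Memo: run/shared/lean/prim/pcint/REDUCTIONS.md §B3m.
-/

namespace Summit.CriticalPhenomena.PercolationContinuityZ3.Theorems.Pcint

open Finset Literature.Probability.Percolation Literature.Probability.LatticeModels

namespace BondK

open WinK (toSite toL addL adjL toSite_addL toSite_toL adj_iff_adjL toSite_inj length_toL length_addL)
open NawK (KState toM mem_toM WF length_of_WF letters mem_letters nodup_letters l1L)

variable {d : ℕ}

/-! ### The kernel corner-third count -/

/-- Kernel CORNER-THIRD test of the letter `b`: det-paying, and `e_a + e_b = q₁ + e_a` for a remembered `q₁` of age `1`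
orthogonal to `a`. [folklore] -/
def cm3P (d kc : ℕ) (L : KState) (a b : Fin d × Bool) : Bool :=
  cdetP d kc L a b &&
    L.any fun q => (q.2 == 1) && (q.1.getD a.1.1 0 == 0) && decide (addL (toL d a) (toL d b) = addL q.1 (toL d a))

/-- Kernel corner-third count (mirror of `cmu`). [folklore] -/
def cmuK (d kc : ℕ) (L : KState) (a : Fin d × Bool) : ℕ := ((letters d).filter fun b => cm3P d kc L a b).length

/-- `cmuK ≤ 2d`. [folklore] -/
theorem cmuK_le (kc : ℕ) (L : KState) (a : Fin d × Bool) : cmuK d kc L a ≤ 2 * d :=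
  (List.length_filter_le _ _).trans (le_of_eq NawK.length_letters)

/-! ### Soundness of the corner-third count -/

/-- **A kernel corner-third letter is a corner-third site.** [folklore] -/
theorem mem_cm3Set_of_cm3P {kc : ℕ} {L : KState} (hL : WF d L = true) {a b : Fin d × Bool} (h : cm3P d kc L a b = true) :
    stepVec a + stepVec b ∈ cm3Set kc (toM L : MState d) a := by
  classical
  unfold cm3P at h
  simp only [Bool.and_eq_true, List.any_eq_true, beq_iff_eq, decide_eq_true_eq] at h
  obtain ⟨hdet, x, hx, ⟨h1, h0⟩, heq⟩ := h
  have hxl := length_of_WF hL hx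
  have hsite : (toSite (addL (toL d a) (toL d b)) : Site d) = stepVec a + stepVec b := by
    rw [toSite_addL (length_toL a) (length_toL b), toSite_toL, toSite_toL]
  have hcs : (toSite (addL x.1 (toL d a)) : Site d) = toSite x.1 + stepVec a := by
    rw [toSite_addL hxl (length_toL a), toSite_toL]
  rw [cm3Set, Finset.mem_filter]
  refine ⟨mem_cdetSet_of_cdetP hL hdet, (toSite x.1, x.2), mem_toM.2 ⟨x, hx, rfl⟩, h1, h0, ?_⟩
  rw [← hsite, heq, hcs]

/-- **The kernel corner-third count does not exceed the corner-third count.** [folklore] -/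
theorem cmuK_le_cmu {kc : ℕ} {L : KState} (hL : WF d L = true) (a : Fin d × Bool) :
    cmuK d kc L a ≤ cmu kc (toM L : MState d) a := by
  classical
  unfold cmuK cmu
  have hnd : ((letters d).filter fun b => cm3P d kc L a b).Nodup := nodup_letters.filter _
  rw [← List.toFinset_card_of_nodup hnd]
  refine Finset.card_le_card_of_injOn (fun b => stepVec a + stepVec b) (fun b hb => ?_)
    (fun b _ b' _ h => stepVec_add_injective a h)
  rw [Finset.mem_coe, List.mem_toFinset, List.mem_filter] at hb
  rw [Finset.mem_coe]
  exact mem_cm3Set_of_cm3P hL hb.2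

end BondK

end Summit.CriticalPhenomena.PercolationContinuityZ3.Theorems.Pcint
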